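import Literature.Probability.LatticeModels.OSReconstruction
import HarnessLib

/-!
# `ClusteringToYangMills` — negative-side support: variational (Rayleigh) lower bounds on the OS gap norm

Support file for crux `stmt-QuantumFields-9443`
(`Summit.QuantumFields.YangMills.Theses.FradkinShenkerFlow.ClusteringToYangMills`), drefute gen 3 on the
picked line `spectral-requantisation-dock` (Cruxes/ClusteringToYangMills/Lines/spectral-requantisation-dock.lean),
stub GV `stub_gapStability`.  Tree objects only (`IsOSReconstructible`, `osForm`, `TransferData.gapNorm`,
`TransferData.HasMassGap`, `TransferData.norm_inner_pow_apply_sub_le`), nothing posited, no `def`.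

Quantitative companion of the standing disprover's qualitative `not_hasMassGap_of_slowMode`
(Cruxes/ClusteringToYangMills/Disproof.lean §5b): ONE mean-zero bounded positive-time observable `F` bounds
the gap norm of the reconstructed transfer data from BELOW by its OS autocorrelation ratios,
`Re b(F, F ∘ τⁿ) ≤ gapNormⁿ · Re b(F, F)` (`re_osForm_shift_iterate_le`, `re_osForm_shift_le_gapNorm_mul`,
`div_le_gapNorm_of_mode`), hence a mode with one-step ratio `≥ 1 - η` excludes every mass gap `m` with
`e^{-m} < 1 - η` (`not_hasMassGap_of_oneStepMode`), and an `n`-step ratio `≥ θ` forces `gapNorm ≥ θ^{1/n}`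
(`rpow_inv_le_gapNorm_of_mode`); with SITE reflection positivity as well (`Θ = τ ∘ Θ₀`), Cauchy–Schwarz in the
site OS space gives the log-convexity step and `SiteCS.autocorr_coeff_le_gapNorm : Re b(F,F) / ∫‖F‖² ≤ gapNorm`
for TIME-ZERO mean-zero `F`.  This is the inequality behind the kill of `stub_gapStability` for `π₁(G) ≠ 1`
('t Hooft magnetic-flux indicator of `SO(3)` lattice gauge theory as the slow mode:
Negative-notes/stub_gapStability-gen3.md) and the shape of the WINDOW clause any repaired GV′ must carry (a slow
mode inside the exceptional block is allowed, outside it is not). [folklore]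
-/

open MeasureTheory
open scoped InnerProductSpace ComplexConjugate

namespace Summit.QuantumFields.YangMills.Cruxes.ClusteringToYangMills.DrefuteGen3

open Literature.Probability.LatticeModels

variable {Ω : Type*} {mΩ : MeasurableSpace Ω} {μ : Measure Ω}
  {reflect shift : Ω → Ω} {mpos : MeasurableSpace Ω}

/-- **`n`-step Rayleigh bound.**  For an OS-reconstructible `(μ, Θ, τ, 𝓔₊)` and a bounded `𝓔₊`-measurable
`F` of mean zero, `Re b(F, F ∘ τⁿ) ≤ ‖T P_{Ω^⊥}‖ⁿ · Re b(F, F)`: `⟪Ω, ιF⟫ = ∫ F dμ = 0`, so the tree's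
`norm_inner_pow_apply_sub_le` reads `‖⟪ιF, Tⁿ ιF⟫‖ ≤ ‖ιF‖² gapNormⁿ`, and `‖ιF‖² = Re b(F, F)`,
`⟪ιF, Tⁿ ιF⟫ = b(F, F ∘ τⁿ)` (OS dictionary). [folklore] -/
theorem re_osForm_shift_iterate_le [IsProbabilityMeasure μ]
    (h : IsOSReconstructible μ reflect shift mpos)
    {F : Ω → ℂ} (hF : IsBoundedMeasurable mpos F) (hmean : ∫ ω, F ω ∂μ = 0) (n : ℕ) :
    (osForm μ reflect F (F ∘ shift^[n])).re ≤
      h.transferData.gapNorm ^ n * (osForm μ reflect F F).re := by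
  set v := h.osMap F with hv
  have hΩ : ⟪h.transferData.vacuum, v⟫_ℂ = 0 := by
    rw [hv, ← h.isOSRealisation.integral_eq_inner_vacuum hF, hmean]
  have h1 : ⟪v, (h.transferData.T ^ n) v⟫_ℂ = osForm μ reflect F (F ∘ shift^[n]) := by
    rw [IsOSReconstructible.transferData_T, hv, h.inner_osMap_transfer_pow_osMap hF hF n, osForm_def]
    rfl
  have h2 : ⟪v, v⟫_ℂ = osForm μ reflect F F := by
    rw [hv, h.inner_osMap_osMap hF hF, osForm_def]
  have h3 : ‖⟪v, (h.transferData.T ^ n) v⟫_ℂ‖ ≤ ‖v‖ * ‖v‖ * h.transferData.gapNorm ^ n := by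
    have := h.transferData.norm_inner_pow_apply_sub_le v v n
    rwa [hΩ, mul_zero, sub_zero] at this
  have h4 : (osForm μ reflect F F).re = ‖v‖ ^ 2 := by
    rw [← h2]
    exact inner_self_eq_norm_sq (𝕜 := ℂ) v
  calc (osForm μ reflect F (F ∘ shift^[n])).re
      ≤ ‖osForm μ reflect F (F ∘ shift^[n])‖ := Complex.re_le_norm _
    _ = ‖⟪v, (h.transferData.T ^ n) v⟫_ℂ‖ := by rw [h1]
    _ ≤ ‖v‖ * ‖v‖ * h.transferData.gapNorm ^ n := h3
    _ = h.transferData.gapNorm ^ n * (osForm μ reflect F F).re := by rw [h4]; ring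

/-- **One-step Rayleigh bound**: `Re b(F, F ∘ τ) ≤ gapNorm · Re b(F, F)` for mean-zero `F`. [folklore] -/
theorem re_osForm_shift_le_gapNorm_mul [IsProbabilityMeasure μ]
    (h : IsOSReconstructible μ reflect shift mpos)
    {F : Ω → ℂ} (hF : IsBoundedMeasurable mpos F) (hmean : ∫ ω, F ω ∂μ = 0) :
    (osForm μ reflect F (F ∘ shift)).re ≤
      h.transferData.gapNorm * (osForm μ reflect F F).re := by
  simpa using re_osForm_shift_iterate_le h hF hmean 1

/-- **Corollary (the form used against GV).**  If moreover `Re b(F, F) > 0`, then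
`gapNorm ≥ Re b(F, F ∘ τ) / Re b(F, F)`. [folklore] -/
theorem div_le_gapNorm_of_mode [IsProbabilityMeasure μ]
    (h : IsOSReconstructible μ reflect shift mpos)
    {F : Ω → ℂ} (hF : IsBoundedMeasurable mpos F) (hmean : ∫ ω, F ω ∂μ = 0)
    (hpos : 0 < (osForm μ reflect F F).re) :
    (osForm μ reflect F (F ∘ shift)).re / (osForm μ reflect F F).re ≤ h.transferData.gapNorm := by
  rw [div_le_iff₀ hpos]
  exact re_osForm_shift_le_gapNorm_mul h hF hmean

/-- **No mass gap beyond the one-step autocorrelation rate** (with the tree's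
`TransferData.HasMassGap m := 0 < m ∧ gapNorm ≤ e^{-m}`): a mean-zero mode with
`Re b(F, F ∘ τ) ≥ (1 - η) Re b(F, F) > 0` excludes every gap `m` with `e^{-m} < 1 - η`. [folklore] -/
theorem not_hasMassGap_of_oneStepMode [IsProbabilityMeasure μ]
    (h : IsOSReconstructible μ reflect shift mpos)
    {F : Ω → ℂ} (hF : IsBoundedMeasurable mpos F) (hmean : ∫ ω, F ω ∂μ = 0)
    (hpos : 0 < (osForm μ reflect F F).re) {η : ℝ}
    (hslow : (1 - η) * (osForm μ reflect F F).re ≤ (osForm μ reflect F (F ∘ shift)).re)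
    {m : ℝ} (hm : Real.exp (-m) < 1 - η) : ¬ h.transferData.HasMassGap m := by
  intro hgap
  have h1 := re_osForm_shift_le_gapNorm_mul h hF hmean
  have h2 : (1 - η) * (osForm μ reflect F F).re ≤
      h.transferData.gapNorm * (osForm μ reflect F F).re := hslow.trans h1
  have h3 : 1 - η ≤ h.transferData.gapNorm := le_of_mul_le_mul_right h2 hpos
  have h4 := hgap.2
  linarith

/-- **`n`-step form**: an `n`-step autocorrelation ratio `≥ θ ≥ 0` (`n ≥ 1`) forces `gapNorm ≥ θ^{1/n}` —
the rate read off ANY single time separation bounds the gap. [folklore] -/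
theorem rpow_inv_le_gapNorm_of_mode [IsProbabilityMeasure μ]
    (h : IsOSReconstructible μ reflect shift mpos)
    {F : Ω → ℂ} (hF : IsBoundedMeasurable mpos F) (hmean : ∫ ω, F ω ∂μ = 0)
    (hpos : 0 < (osForm μ reflect F F).re) {θ : ℝ} (hθ : 0 ≤ θ) {n : ℕ} (hn : n ≠ 0)
    (hslow : θ * (osForm μ reflect F F).re ≤ (osForm μ reflect F (F ∘ shift^[n])).re) :
    θ ^ ((n : ℝ)⁻¹) ≤ h.transferData.gapNorm := by
  have h1 := re_osForm_shift_iterate_le h hF hmean n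
  have h2 : θ * (osForm μ reflect F F).re ≤ h.transferData.gapNorm ^ n * (osForm μ reflect F F).re :=
    hslow.trans h1
  have h3 : θ ≤ h.transferData.gapNorm ^ n := le_of_mul_le_mul_right h2 hpos
  have hg : 0 ≤ h.transferData.gapNorm := h.transferData.gapNorm_nonneg
  have hn' : (0 : ℝ) < n := by exact_mod_cast Nat.pos_of_ne_zero hn
  calc θ ^ ((n : ℝ)⁻¹) ≤ (h.transferData.gapNorm ^ n) ^ ((n : ℝ)⁻¹) :=
        Real.rpow_le_rpow hθ h3 (inv_nonneg.2 hn'.le)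
    _ = h.transferData.gapNorm := by
        rw [← Real.rpow_natCast, ← Real.rpow_mul hg, mul_inv_cancel₀ hn'.ne', Real.rpow_one]

/-! ## Site-reflection Cauchy–Schwarz: the one-step autocorrelation COEFFICIENT bounds the gap norm

For lattice states the positive-time algebra `𝓔₊` (links based at times `≥ 0`) is positive for BOTH the
bond reflection `Θ` (plane `x₀ = -1/2`) and the site reflection `Θ₀` (plane `x₀ = 0`), with `Θ = τ ∘ Θ₀`
as configuration maps.  If `μ` is OS-reconstructible for both, a TIME-ZERO observable `F` (`F ∘ Θ₀ = F`)
has `b_Θ(F, F) = ⟪ι₀(F ∘ τ), ι₀ F⟫₀` and `b_Θ(F, F ∘ τ) = ‖ι₀(F ∘ τ)‖₀²`, `‖ι₀ F‖₀² = ∫ ‖F‖²`, so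
Cauchy–Schwarz in the site space gives the log-convexity step `(Re b_Θ(F,F))² ≤ Re b_Θ(F, F∘τ) · ∫ ‖F‖²`,
and with the Rayleigh bound: `gapNorm_Θ ≥ Re b_Θ(F, F) / ∫ ‖F‖²` — for `F = z - E z`, `z = ±1` a flux
indicator, the right side is `1 - p/(2 P₊ P₋)` (`p` = one-step flip probability). -/

namespace SiteCS

/-- **Log-convexity step from site reflection positivity.**  [folklore] -/
theorem sq_re_osForm_le_of_site [IsProbabilityMeasure μ] {reflect₀ : Ω → Ω}
    (h₀ : IsOSReconstructible μ reflect₀ shift mpos)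
    (hΘ : ∀ ω, reflect ω = shift (reflect₀ ω))
    {F : Ω → ℂ} (hF : IsBoundedMeasurable mpos F) (hF₀ : ∀ ω, F (reflect₀ ω) = F ω) :
    (osForm μ reflect F F).re ^ 2 ≤
      (osForm μ reflect F (F ∘ shift)).re * ∫ ω, ‖F ω‖ ^ 2 ∂μ := by
  have hFτ : IsBoundedMeasurable mpos (F ∘ shift) := h₀.isBoundedMeasurable_comp_shift hF
  -- the three dictionary identities
  have e1 : osForm μ reflect F F = ⟪h₀.osMap (F ∘ shift), h₀.osMap F⟫_ℂ := by
    rw [h₀.inner_osMap_osMap hFτ hF, osForm_def]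
    refine integral_congr_ae (ae_of_all _ fun ω => ?_)
    simp only [Function.comp_apply, hΘ]
  have e2 : osForm μ reflect F (F ∘ shift) = ⟪h₀.osMap (F ∘ shift), h₀.osMap (F ∘ shift)⟫_ℂ := by
    rw [h₀.inner_osMap_osMap hFτ hFτ, osForm_def]
    refine integral_congr_ae (ae_of_all _ fun ω => ?_)
    simp only [Function.comp_apply, hΘ]
  have e3 : (∫ ω, ‖F ω‖ ^ 2 ∂μ : ℝ) = (⟪h₀.osMap F, h₀.osMap F⟫_ℂ).re := by
    letI : MeasurableSpace Ω := mΩ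
    rw [h₀.inner_osMap_osMap hF hF]
    have : (fun ω => conj (F (reflect₀ ω)) * F ω) = fun ω => ((‖F ω‖ ^ 2 : ℝ) : ℂ) := by
      funext ω
      rw [hF₀ ω, Complex.conj_mul' (F ω)]
      push_cast
      ring
    rw [this, integral_complex_ofReal, Complex.ofReal_re]
  -- Cauchy–Schwarz in the site OS space
  set x := h₀.osMap (F ∘ shift)
  set y := h₀.osMap F
  have hcs : ‖⟪x, y⟫_ℂ‖ ^ 2 ≤ ‖x‖ ^ 2 * ‖y‖ ^ 2 := by
    have := norm_inner_le_norm (𝕜 := ℂ) x y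
    have hx := norm_nonneg x
    have hy := norm_nonneg y
    nlinarith [norm_nonneg (⟪x, y⟫_ℂ)]
  have hx2 : ‖x‖ ^ 2 = (osForm μ reflect F (F ∘ shift)).re := by
    rw [e2]; exact (inner_self_eq_norm_sq (𝕜 := ℂ) x).symm
  have hy2 : ‖y‖ ^ 2 = ∫ ω, ‖F ω‖ ^ 2 ∂μ := by
    rw [e3]; exact (inner_self_eq_norm_sq (𝕜 := ℂ) y).symm
  calc (osForm μ reflect F F).re ^ 2 ≤ ‖osForm μ reflect F F‖ ^ 2 := by
        have h1 := Complex.abs_re_le_norm (osForm μ reflect F F)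
        have h2 : |(osForm μ reflect F F).re| ^ 2 = (osForm μ reflect F F).re ^ 2 := sq_abs _
        rw [← h2]
        exact pow_le_pow_left₀ (abs_nonneg _) h1 2
    _ = ‖⟪x, y⟫_ℂ‖ ^ 2 := by rw [e1]
    _ ≤ ‖x‖ ^ 2 * ‖y‖ ^ 2 := hcs
    _ = (osForm μ reflect F (F ∘ shift)).re * ∫ ω, ‖F ω‖ ^ 2 ∂μ := by rw [hx2, hy2]

/-- **The one-step autocorrelation coefficient of a time-zero mean-zero observable bounds the bond-OS
gap norm from below**: `Re b_Θ(F, F) / ∫ ‖F‖² ≤ gapNorm_Θ` (Rayleigh bound ∘ site Cauchy–Schwarz).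
For the thresholded 't Hooft flux indicator `z = ±1` of `SO(3)` LGT and `F = z - E z` the left side is
`1 - p/(2 P₊ P₋)`. [folklore] -/
theorem autocorr_coeff_le_gapNorm [IsProbabilityMeasure μ] {reflect₀ : Ω → Ω}
    (h : IsOSReconstructible μ reflect shift mpos) (h₀ : IsOSReconstructible μ reflect₀ shift mpos)
    (hΘ : ∀ ω, reflect ω = shift (reflect₀ ω))
    {F : Ω → ℂ} (hF : IsBoundedMeasurable mpos F) (hF₀ : ∀ ω, F (reflect₀ ω) = F ω)
    (hmean : ∫ ω, F ω ∂μ = 0) (hpos : 0 < (osForm μ reflect F F).re) :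
    (osForm μ reflect F F).re / (∫ ω, ‖F ω‖ ^ 2 ∂μ) ≤ h.transferData.gapNorm := by
  have hcs := sq_re_osForm_le_of_site h₀ hΘ hF hF₀
  have hray := re_osForm_shift_le_gapNorm_mul h hF hmean
  -- ∫ ‖F‖² > 0 (else the left side of `hcs` would vanish)
  have hL2 : 0 < ∫ ω, ‖F ω‖ ^ 2 ∂μ := by
    by_contra hle
    push Not at hle
    have h1 : (osForm μ reflect F F).re ^ 2 ≤ 0 := by
      refine hcs.trans ?_
      have hnn : 0 ≤ (osForm μ reflect F (F ∘ shift)).re := h.rp_shift F hF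
      nlinarith
    nlinarith
  rw [div_le_iff₀ hL2]
  -- (Re b(F,F))² ≤ Re b(F,F∘τ) ∫‖F‖² ≤ gapNorm Re b(F,F) ∫‖F‖²
  have h2 : (osForm μ reflect F F).re ^ 2 ≤
      h.transferData.gapNorm * (osForm μ reflect F F).re * ∫ ω, ‖F ω‖ ^ 2 ∂μ := by
    refine hcs.trans ?_
    have := mul_le_mul_of_nonneg_right hray hL2.le
    linarith
  have h3 : (osForm μ reflect F F).re * (osForm μ reflect F F).re ≤
      (osForm μ reflect F F).re * (h.transferData.gapNorm * ∫ ω, ‖F ω‖ ^ 2 ∂μ) := by nlinarith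
  exact le_of_mul_le_mul_left h3 hpos

end SiteCS

end Summit.QuantumFields.YangMills.Cruxes.ClusteringToYangMills.DrefuteGen3
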